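import Mathlib

/-!
# FS-U1″ mode lemma — Poincare (`TurbBounds/FSU1/Mode/M02Poincare.lean`)

Quarter-wave Poincaré inequality on a layer via the Picone weight `c·cot(cz)` (FS-PROOF-DRAFT §3.3 ingredient).

Cell-made mathematics of FS-PROOF-DRAFT §3 (pub-turb-sos), kernel-checked; generated from the design compose file
`StageF_compose.check.lean` (96c4b9bf…) by `build_mode_split.py`.  HONEST FRAMING: rigorous bounds for the stated PDE and boundary conditions; no claim about physical turbulence beyond the bound.
-/

open Real intervalIntegral MeasureTheory Set

namespace Summit.NavierStokesRegularity.TurbBounds.FSU1.Mode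


/-- The Picone weight `w(z) = c·cot(cz)`. -/
noncomputable def wt (c z : ℝ) : ℝ := c * Real.cos (c * z) / Real.sin (c * z)

/-- Derivative of the Picone weight `w(z) = c·cot(cz)` on `(0, π/(2c))`: `w′ = −c²/sin²(cz)`. -/
theorem hasDerivAt_wt (c z : ℝ) (hs : Real.sin (c * z) ≠ 0) :
    HasDerivAt (wt c) (-(c ^ 2) / Real.sin (c * z) ^ 2) z := by
  have hlin : HasDerivAt (fun z : ℝ => c * z) c z := by
    simpa using (hasDerivAt_id z).const_mul c
  have hcos : HasDerivAt (fun z : ℝ => c * Real.cos (c * z)) (c * (-Real.sin (c * z) * c)) z :=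
    ((Real.hasDerivAt_cos (c * z)).comp z hlin).const_mul c
  have hsin : HasDerivAt (fun z : ℝ => Real.sin (c * z)) (Real.cos (c * z) * c) z :=
    (Real.hasDerivAt_sin (c * z)).comp z hlin
  have h := hcos.div hsin hs
  have hsc : Real.sin (c * z) ^ 2 + Real.cos (c * z) ^ 2 = 1 := Real.sin_sq_add_cos_sq _
  have e : (c * (-Real.sin (c * z) * c) * Real.sin (c * z) - c * Real.cos (c * z) * (Real.cos (c * z) * c))
      / Real.sin (c * z) ^ 2 = -(c ^ 2) / Real.sin (c * z) ^ 2 := by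
    rw [div_left_inj' (pow_ne_zero 2 hs)]
    linear_combination (-(c ^ 2)) * hsc
  unfold wt
  exact h.congr_deriv e

/-- `c²/sin² = c² + w²`. -/
theorem csq_div_sin_sq (c z : ℝ) (hs : Real.sin (c * z) ≠ 0) :
    c ^ 2 / Real.sin (c * z) ^ 2 = c ^ 2 + wt c z ^ 2 := by
  unfold wt
  have hsc : Real.sin (c * z) ^ 2 + Real.cos (c * z) ^ 2 = 1 := Real.sin_sq_add_cos_sq _
  field_simp
  nlinarith [hsc]

/-- `x·cos x ≤ sin x` on `[0, π/2)`, i.e. `w(η) ≤ 1/η`. -/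
theorem mul_cos_le_sin {x : ℝ} (h0 : 0 ≤ x) (h1 : x < π / 2) : x * Real.cos x ≤ Real.sin x := by
  rcases h0.eq_or_lt with rfl | h0'
  · simp
  have hc : 0 < Real.cos x := Real.cos_pos_of_mem_Ioo ⟨by linarith, h1⟩
  have ht : x < Real.tan x := Real.lt_tan h0' h1
  rw [Real.tan_eq_sin_div_cos, lt_div_iff₀ hc] at ht
  exact ht.le

/-- **Quarter-wave Poincaré inequality (sharp constant).** -/
theorem quarter_wave_poincare {f f' : ℝ → ℝ} (hf : ∀ x, HasDerivAt f (f' x) x) (hf' : Continuous f')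
    (h0 : f 0 = 0) {δ : ℝ} (hδ : 0 < δ) :
    (π / (2 * δ)) ^ 2 * ∫ z in (0:ℝ)..δ, f z ^ 2 ≤ ∫ z in (0:ℝ)..δ, f' z ^ 2 := by
  set c : ℝ := π / (2 * δ) with hcdef
  have hc : 0 < c := by positivity
  have hfc : Continuous f := continuous_iff_continuousAt.mpr fun x => (hf x).continuousAt
  -- sin (c z) > 0 and cos (c z) ≥ 0 on (0, δ]
  have hcz_lt : ∀ z, z ≤ δ → c * z ≤ π / 2 := by
    intro z hz
    have : c * z ≤ c * δ := mul_le_mul_of_nonneg_left hz hc.le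
    have hcd : c * δ = π / 2 := by rw [hcdef]; field_simp
    linarith
  have hsinpos : ∀ z, 0 < z → z ≤ δ → 0 < Real.sin (c * z) := by
    intro z hz hzd
    exact Real.sin_pos_of_pos_of_lt_pi (mul_pos hc hz) (by linarith [hcz_lt z hzd, Real.pi_pos])
  -- a bound M on |f'| over [0, δ] and the mean-value bound |f z| ≤ M z
  obtain ⟨M, hM⟩ := (isCompact_Icc : IsCompact (Icc (0:ℝ) δ)).exists_bound_of_continuousOn hf'.continuousOn
  have hM0 : 0 ≤ M := le_trans (norm_nonneg _) (hM 0 ⟨le_rfl, hδ.le⟩)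
  have hMVT : ∀ z ∈ Icc (0:ℝ) δ, |f z| ≤ M * z := by
    intro z hz
    have key := (convex_Icc (0:ℝ) δ).norm_image_sub_le_of_norm_hasDerivWithin_le
      (fun x _ => (hf x).hasDerivWithinAt) (fun x hx => hM x hx) ⟨le_rfl, hδ.le⟩ hz
    simpa [h0, Real.norm_eq_abs, abs_of_nonneg hz.1] using key
  -- integrability of the continuous integrands
  have hi_f2 : ∀ a b : ℝ, IntervalIntegrable (fun z => f z ^ 2) volume a b :=
    fun a b => (hfc.pow 2).intervalIntegrable a b
  have hi_fp2 : ∀ a b : ℝ, IntervalIntegrable (fun z => f' z ^ 2) volume a b :=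
    fun a b => (hf'.pow 2).intervalIntegrable a b
  -- the key estimate on [η, δ]
  have key : ∀ η, 0 < η → η < δ →
      c ^ 2 * ∫ z in η..δ, f z ^ 2 ≤ (∫ z in η..δ, f' z ^ 2) + f η ^ 2 * wt c η := by
    intro η hη hηδ
    have hsne : ∀ z ∈ Icc η δ, Real.sin (c * z) ≠ 0 :=
      fun z hz => (hsinpos z (lt_of_lt_of_le hη hz.1) hz.2).ne'
    -- g = f² w and its derivative D
    set D : ℝ → ℝ := fun z => (f' z * f z + f z * f' z) * wt c z + f z * f z * (-(c ^ 2) / Real.sin (c * z) ^ 2)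
    have hderiv : ∀ z ∈ uIcc η δ, HasDerivAt (fun z => f z * f z * wt c z) (D z) z := by
      intro z hz
      rw [uIcc_of_le hηδ.le] at hz
      exact ((hf z).mul (hf z)).mul (hasDerivAt_wt c z (hsne z hz))
    -- continuity of w and D on [η, δ]
    have hw_cont : ContinuousOn (wt c) (Icc η δ) := by
      unfold wt
      refine ContinuousOn.div ?_ ?_ hsne
      · exact (continuous_const.mul (Real.continuous_cos.comp (continuous_const.mul continuous_id))).continuousOn
      · exact (Real.continuous_sin.comp (continuous_const.mul continuous_id)).continuousOn
    have hsin2_cont : ContinuousOn (fun z => -(c ^ 2) / Real.sin (c * z) ^ 2) (Icc η δ) := by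
      refine ContinuousOn.div continuousOn_const ?_ (fun z hz => pow_ne_zero 2 (hsne z hz))
      exact ((Real.continuous_sin.comp (continuous_const.mul continuous_id)).pow 2).continuousOn
    have hD_cont : ContinuousOn D (Icc η δ) := by
      have h1 : ContinuousOn (fun z => f' z * f z + f z * f' z) (Icc η δ) :=
        ((hf'.mul hfc).add (hfc.mul hf')).continuousOn
      have h2 : ContinuousOn (fun z => f z * f z) (Icc η δ) := (hfc.mul hfc).continuousOn
      exact (h1.mul hw_cont).add (h2.mul hsin2_cont)
    have hi_D : IntervalIntegrable D volume η δ :=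
      (hD_cont.mono (by rw [uIcc_of_le hηδ.le])).intervalIntegrable
    -- FTC: ∫ D = g δ - g η = - f η² w η
    have hFTC : ∫ z in η..δ, D z = f δ * f δ * wt c δ - f η * f η * wt c η :=
      integral_eq_sub_of_hasDerivAt hderiv hi_D
    have hwδ : wt c δ = 0 := by
      have hcd : c * δ = π / 2 := by rw [hcdef]; field_simp
      simp [wt, hcd, Real.cos_pi_div_two]
    -- pointwise: c² f² ≤ f'² - D on [η, δ]
    have hpt : ∀ z ∈ Icc η δ, c ^ 2 * f z ^ 2 ≤ f' z ^ 2 - D z := by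
      intro z hz
      have hid := csq_div_sin_sq c z (hsne z hz)
      have : f' z ^ 2 - D z - c ^ 2 * f z ^ 2 = (f' z - f z * wt c z) ^ 2 := by
        simp only [D]
        rw [show -(c ^ 2) / Real.sin (c * z) ^ 2 = -(c ^ 2 / Real.sin (c * z) ^ 2) by ring, hid]
        ring
      nlinarith [sq_nonneg (f' z - f z * wt c z)]
    have hmono : ∫ z in η..δ, c ^ 2 * f z ^ 2 ≤ ∫ z in η..δ, (f' z ^ 2 - D z) :=
      integral_mono_on hηδ.le ((hi_f2 η δ).const_mul _) ((hi_fp2 η δ).sub hi_D) hpt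
    rw [intervalIntegral.integral_const_mul, intervalIntegral.integral_sub (hi_fp2 η δ) hi_D, hFTC, hwδ] at hmono
    nlinarith [hmono]
  -- the boundary term is ≤ M² η
  have hbdry : ∀ η, 0 < η → η < δ → f η ^ 2 * wt c η ≤ M ^ 2 * η := by
    intro η hη hηδ
    have hcη : c * η < π / 2 := by
      have : c * η < c * δ := mul_lt_mul_of_pos_left hηδ hc
      have hcd : c * δ = π / 2 := by rw [hcdef]; field_simp
      linarith
    have hs := hsinpos η hη hηδ.le
    have hcos : 0 ≤ Real.cos (c * η) := Real.cos_nonneg_of_mem_Icc ⟨by nlinarith [mul_pos hc hη], by linarith⟩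
    have hw0 : 0 ≤ wt c η := by unfold wt; positivity
    have hw1 : wt c η * η ≤ 1 := by
      unfold wt
      rw [div_mul_eq_mul_div, div_le_one hs]
      have := mul_cos_le_sin (mul_pos hc hη).le hcη
      nlinarith [this]
    have hfη : |f η| ≤ M * η := hMVT η ⟨hη.le, hηδ.le⟩
    have hf2 : f η ^ 2 ≤ (M * η) ^ 2 := by
      calc f η ^ 2 = |f η| ^ 2 := (sq_abs _).symm
        _ ≤ (M * η) ^ 2 := pow_le_pow_left₀ (abs_nonneg _) hfη 2
    calc f η ^ 2 * wt c η ≤ (M * η) ^ 2 * wt c η := mul_le_mul_of_nonneg_right hf2 hw0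
      _ = M ^ 2 * η * (wt c η * η) := by ring
      _ ≤ M ^ 2 * η * 1 := mul_le_mul_of_nonneg_left hw1 (by positivity)
      _ = M ^ 2 * η := mul_one _
  -- the short piece [0, η]: c² ∫₀^η f² ≤ c² (M δ)² η
  have hshort : ∀ η, 0 < η → η < δ → c ^ 2 * ∫ z in (0:ℝ)..η, f z ^ 2 ≤ c ^ 2 * ((M * δ) ^ 2 * η) := by
    intro η hη hηδ
    refine mul_le_mul_of_nonneg_left ?_ (sq_nonneg c)
    have hb : ∀ z ∈ Set.uIoc (0:ℝ) η, ‖f z ^ 2‖ ≤ (M * δ) ^ 2 := by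
      intro z hz
      rw [uIoc_of_le hη.le] at hz
      have hfz : |f z| ≤ M * z := hMVT z ⟨hz.1.le, by linarith [hz.2]⟩
      have hMz : M * z ≤ M * δ := mul_le_mul_of_nonneg_left (by linarith [hz.2]) hM0
      rw [Real.norm_eq_abs, abs_of_nonneg (sq_nonneg _), ← sq_abs]
      exact pow_le_pow_left₀ (abs_nonneg _) (hfz.trans hMz) 2
    have := norm_integral_le_of_norm_le_const hb
    rw [Real.norm_eq_abs, sub_zero, abs_of_pos hη] at this
    exact le_trans (le_abs_self _) this
  -- assemble: for every η ∈ (0, δ), c² ∫₀^δ f² ≤ ∫₀^δ f'² + K η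
  have hK : ∀ η, 0 < η → η < δ →
      c ^ 2 * ∫ z in (0:ℝ)..δ, f z ^ 2 ≤ (∫ z in (0:ℝ)..δ, f' z ^ 2) + (M ^ 2 + c ^ 2 * (M * δ) ^ 2) * η := by
    intro η hη hηδ
    have hsplit_f : ∫ z in (0:ℝ)..δ, f z ^ 2 = (∫ z in (0:ℝ)..η, f z ^ 2) + ∫ z in η..δ, f z ^ 2 :=
      (integral_add_adjacent_intervals (hi_f2 0 η) (hi_f2 η δ)).symm
    have hsplit_fp : ∫ z in (0:ℝ)..δ, f' z ^ 2 = (∫ z in (0:ℝ)..η, f' z ^ 2) + ∫ z in η..δ, f' z ^ 2 :=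
      (integral_add_adjacent_intervals (hi_fp2 0 η) (hi_fp2 η δ)).symm
    have hnn : 0 ≤ ∫ z in (0:ℝ)..η, f' z ^ 2 := integral_nonneg hη.le (fun z _ => sq_nonneg _)
    have h1 := key η hη hηδ
    have h2 := hbdry η hη hηδ
    have h3 := hshort η hη hηδ
    rw [hsplit_f, hsplit_fp, mul_add]
    nlinarith [h1, h2, h3, hnn]
  -- let η → 0
  refine le_of_forall_pos_le_add fun ε hε => ?_
  set K := M ^ 2 + c ^ 2 * (M * δ) ^ 2 with hKdef
  have hK0 : 0 ≤ K := by positivity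
  set η := min (δ / 2) (ε / (K + 1)) with hηdef
  have hη : 0 < η := lt_min (by linarith) (by positivity)
  have hηδ : η < δ := lt_of_le_of_lt (min_le_left _ _) (by linarith)
  have hηε : K * η ≤ ε := by
    have : η ≤ ε / (K + 1) := min_le_right _ _
    have hK1 : 0 < K + 1 := by linarith
    calc K * η ≤ K * (ε / (K + 1)) := mul_le_mul_of_nonneg_left this hK0
      _ ≤ (K + 1) * (ε / (K + 1)) := mul_le_mul_of_nonneg_right (by linarith) (by positivity)
      _ = ε := by field_simp
  have := hK η hη hηδ
  linarith

end Summit.NavierStokesRegularity.TurbBounds.FSU1.Mode
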